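/-
Copyright (c) 2026 the pub-hodgecm-mathlib formalisation cell (harness21).  Prover seat hodgecm-mathlib-K2E3-p23 (g5), HCML Track B «K2-LIT» ∕ h413
(`stmt-HodgeConjecture-24833`), line `K2_E3_EllipticInputs`, unit U12 «Characters», road «GL-[M6]-sc» (line lead K2E3-p23 (g5), dealer K2E3-plan (g3)),
ASM-final: THE LEAF (11-3-split-sc-NE) `U12Characters.sig_K2E3GL3ModUniformizerNonEllEstimates` — statement bytes VERBATIM, sorry-free.  2026-09-04.
-/
import Summits.HodgeConjecture.HodgeConjecture.Theorems.K2E3GL3ModUniformizerNonEllEstimatesOfMixed      -- ★ p858564 (this seat): the assembly modulo `HM`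
import Summits.HodgeConjecture.HodgeConjecture.Theorems.K2E3GL3SupercuspOrbitalSliceCancellationMixed   -- ★ (K2E3-p21 g5): the mixed per-point `hcanc`
import HarnessLib

/-!
# Road «GL-[M6]-sc», ASM-final: THE LEAF (11-3-split-sc-NE) — Harish-Chandra's non-elliptic estimates for the truncated conjugation averages of a supercuspidal
# matrix coefficient on `G' = GL₃(F) ⧸ ϖ^ℤ` (Part VII §3, Theorems 15, 18–20): `∃ Ω Fl M, (a.e. convergence off the elliptic set) ∧ (a.e. domination) ∧ M ∈ L¹_loc`

Cell `pub/hodgecm-mathlib` (D-0151), Track B «K2-LIT», crux H413 = `stmt-HodgeConjecture-24833`, route of record `HCCMUnconditional`.  Lane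
`--supports stmt-HodgeConjecture-24833 --as helper`; THEOREMS ONLY (no `def`, no `instance`, no `notation`, no named-fact hypothesis, no `sorry`); count-neutral.
The TYPE of `nonEllEstimates_modUniformizer` is the statement of the hosted leaf `Cruxes/H413/Lines/K2_E3_EllipticInputsSigs_U12Characters.lean :362
sig_K2E3GL3ModUniformizerNonEllEstimates` (U12 ED. 19∕20, = hypothesis `hNE` of ★ B6-final `charLocIntNear_gl3_supercuspidal_of_nonell`) token for token, so the dealer's
tie is `:= nonEllEstimates_modUniformizer`.

§1 `hcanc_mixed_pointwise` = the binder `HM` of ★ `nonEllEstimates_of_hcancMixed` with `A = 108`, read off ★ K2E3-p21 (g5)'s mixed per-point cancellation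
`K2E3GL3SupercuspOrbitalSliceCancellationMixed.setIntegral_conj_eq_setIntegral_inter_mixed` (radius `(9s₀+L+L_d) + (1+2s+4(9s₀+L+L_d)) + s`) at an integral
representative in mixed normal form: companion form (★ `exists_leviBlock_eq_conj_companion` + ★ `exists_conj_eq_of_coe`), `|T|,|N|,|c| ≤ 1` (★ K2E3-p14), `L = L_d = L₀`,
conjugator of height `s = 6h + L₀` (★ T18-mixed-normalised); `45s₀ + 18h + 13L₀ + 1 ≤ 108(s₀+h+L₀+1)`.
§2 **`nonEllEstimates_modUniformizer`**: Borel structures on `F`, `GL₃(F)` chosen inside the proof; `Ω` = ★ `exists_adHeightBall_compactExhaustion_quotScalar` (K2E3-p14 (g5));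
then ★ `nonEllEstimates_of_hcancMixed` ∘ §1.  ROAD «GL-[M6]-sc» (MEMO BLUEPRINT v4): B4-0∕B4-1 (p14, p03), T18 split∕mixed (p14), VOL (p23, p14, p03), T15 (p17, p11), T20 (K2E5-p17,
p21), ASM (p23).
HONEST LABEL: HC_CM is proved only modulo the 7 printed citations (2 remaining named inputs: hLiu418 = stmt-HodgeConjecture-24832, h413 = stmt-HodgeConjecture-24833) until
rung 0 closes; count-neutral helper; closes the hosted leaf (11-3-split-sc-NE) only when the dealer ties it.

## References
* [HarishChandra1970] Harish-Chandra (notes by G. van Dijk), *Harmonic Analysis on Reductive p-adic Groups*, LNM 162 (1970), Part V §6 Thm 15 p. 63; Part VII §2 Thms 18–20 pp. 69–70, §3 pp. 70–73.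
* [Rogawski1990] J. Rogawski, *Automorphic Representations of Unitary Groups in Three Variables* (1990), §12.2 p. 173.
-/

set_option autoImplicit false
-- the mandated namespace repeats the single-problem summit's segment (`HodgeConjecture.HodgeConjecture`)
set_option linter.dupNamespace false

noncomputable section

open MeasureTheory Measure Set Filter Topology
open scoped MatrixGroups NNReal ENNReal WithZero
open Literature.NumberTheory.Automorphic Literature.NumberTheory.GaloisRepresentations Literature.NumberTheory.GaloisRepresentations.IsNonarchimedeanLocalField
open Summit.HodgeConjecture.HodgeConjecture.Cruxes.H413.K2E3GL3ModUniformizerNonEllEstimatesOfMixed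
open Summit.HodgeConjecture.HodgeConjecture.Cruxes.H413.K2E3GL3SupercuspOrbitalSliceCancellationMixed
open Summit.HodgeConjecture.HodgeConjecture.Cruxes.H413.K2E3GL3ModUniformizerNonEllBallMixed
open Summit.HodgeConjecture.HodgeConjecture.Cruxes.H413.K2E3GL3ModUniformizerNonEllBall
open Summit.HodgeConjecture.HodgeConjecture.Cruxes.H413.K2E3GL3MixedCompanionNormalForm
open Summit.HodgeConjecture.HodgeConjecture.Cruxes.H413.K2E3GL3MixedTorusNormForm
open Summit.HodgeConjecture.HodgeConjecture.Cruxes.H413.K2E3GL3TruncatedCharMixedTorusRadius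
open Summit.HodgeConjecture.HodgeConjecture.Cruxes.H413.K2E3GL3HeightBallExhaustion
open Summit.HodgeConjecture.HodgeConjecture.Cruxes.H413.K2E3GL3ModUniformizerCocompact

namespace Summit.HodgeConjecture.HodgeConjecture.Cruxes.H413.K2E3GL3ModUniformizerNonEllEstimates

/-! ## §1 The mixed per-point cancellation in the shape `HM` (`A = 108`) -/
section PerPoint

variable {F : Type*} [Field F] [Valued F ℤᵐ⁰] [ValuativeRel F] [(Valued.v : Valuation F ℤᵐ⁰).Compatible] [IsNonarchimedeanLocalField F] [CharZero F]
  [MeasurableSpace F] [BorelSpace F] [MeasurableSpace (GL (Fin 3) F)] [BorelSpace (GL (Fin 3) F)]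
  {ϖ : F} (hϖ : Valued.v ϖ = WithZero.exp (-1 : ℤ)) (hϖ0 : ϖ ≠ 0)
  [((Subgroup.zpowers (Units.mk0 ϖ hϖ0)).map (Matrix.GeneralLinearGroup.scalar (Fin 3))).Normal]
  [MeasurableSpace (GL (Fin 3) F ⧸ (Subgroup.zpowers (Units.mk0 ϖ hϖ0)).map (Matrix.GeneralLinearGroup.scalar (Fin 3)))]
  [BorelSpace (GL (Fin 3) F ⧸ (Subgroup.zpowers (Units.mk0 ϖ hϖ0)).map (Matrix.GeneralLinearGroup.scalar (Fin 3)))]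
  {V : Type*} [AddCommGroup V] [Module ℂ V] (ρ : Representation ℂ (GL (Fin 3) F ⧸ (Subgroup.zpowers (Units.mk0 ϖ hϖ0)).map (Matrix.GeneralLinearGroup.scalar (Fin 3))) V)
  (hρ : ρ.IsSmooth) (hsc : ρ.IsSupercuspidal) {B : V →ₗ⋆[ℂ] V →ₗ[ℂ] ℂ}
  (hBinv : ∀ (g : GL (Fin 3) F ⧸ (Subgroup.zpowers (Units.mk0 ϖ hϖ0)).map (Matrix.GeneralLinearGroup.scalar (Fin 3))) (v w : V), B (ρ g v) (ρ g w) = B v w) (u u' : V)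
  (Ω : CompactExhaustion (GL (Fin 3) F ⧸ (Subgroup.zpowers (Units.mk0 ϖ hϖ0)).map (Matrix.GeneralLinearGroup.scalar (Fin 3))))
  (hmem : ∀ (m : ℕ) (g : GL (Fin 3) F),
    (QuotientGroup.mk g : GL (Fin 3) F ⧸ (Subgroup.zpowers (Units.mk0 ϖ hϖ0)).map (Matrix.GeneralLinearGroup.scalar (Fin 3))) ∈ Ω m ↔
      ∀ i j k l, Valued.v (ϖ ^ m * ((g : Matrix (Fin 3) (Fin 3) F) i j * ((g⁻¹ : GL (Fin 3) F) : Matrix (Fin 3) (Fin 3) F) k l)) ≤ 1)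
  (hK : ∀ (m : ℕ) (k : GL (Fin 3) F), k ∈ glInt 3 F → ∀ x : GL (Fin 3) F ⧸ (Subgroup.zpowers (Units.mk0 ϖ hϖ0)).map (Matrix.GeneralLinearGroup.scalar (Fin 3)),
    ((QuotientGroup.mk k : GL (Fin 3) F ⧸ _) * x ∈ Ω m ↔ x ∈ Ω m) ∧ (x * (QuotientGroup.mk k : GL (Fin 3) F ⧸ _) ∈ Ω m ↔ x ∈ Ω m))
  (μ' : Measure (GL (Fin 3) F ⧸ (Subgroup.zpowers (Units.mk0 ϖ hϖ0)).map (Matrix.GeneralLinearGroup.scalar (Fin 3)))) [μ'.IsHaarMeasure]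

include hϖ hρ hsc hBinv hmem hK in
/-- **THE MIXED PER-POINT CANCELLATION IN THE SHAPE `HM` (`A = 108`).**  For `θ = B u' (ρ · u)` supported in `Ω s₀` and an INTEGRAL representative `g₁` of height `h` in mixed
normal form `y·[[e₀,e₁,0],[e₂,e₃,0],[0,0,e₄]]·y⁻¹` (`χ` of the block irreducible) with `|disc χ_{g₁}| = q^{-L₀}`:
`∃ R₀ ≤ 108·(s₀ + h + L₀ + 1), ∀ n, ∫_{Ω n} θ(z · mk g₁ · z⁻¹) dμ'(z) = ∫_{Ω n ∩ Ω R₀} …` — ★ K2E3-p21 (g5) `setIntegral_conj_eq_setIntegral_inter_mixed` at the companion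
form with `L = L_d = L₀` and a conjugator of height `6h + L₀` (★ T18-mixed-normalised). [cite: HarishChandra1970, Part VII §2 Thms 18, 20 pp. 69–70, §3 pp. 71–73] -/
theorem hcanc_mixed_pointwise {s₀ : ℕ}
    (hθ : ∀ g : GL (Fin 3) F ⧸ (Subgroup.zpowers (Units.mk0 ϖ hϖ0)).map (Matrix.GeneralLinearGroup.scalar (Fin 3)), B u' (ρ g u) ≠ 0 → g ∈ Ω s₀)
    (g₁ y : GL (Fin 3) F) (e : Fin 5 → F) (h L₀ : ℕ)
    (hirr : Irreducible ((!![e 0, e 1; e 2, e 3] : Matrix (Fin 2) (Fin 2) F)).charpoly)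
    (hg : (g₁ : Matrix (Fin 3) (Fin 3) F) = (y : Matrix (Fin 3) (Fin 3) F) * !![e 0, e 1, 0; e 2, e 3, 0; 0, 0, e 4] * ((y⁻¹ : GL (Fin 3) F) : Matrix (Fin 3) (Fin 3) F))
    (hint : ∀ i j, Valued.v ((g₁ : Matrix (Fin 3) (Fin 3) F) i j) ≤ 1)
    (hinv : ∀ i j, Valued.v (ϖ ^ h * ((g₁⁻¹ : GL (Fin 3) F) : Matrix (Fin 3) (Fin 3) F) i j) ≤ 1)
    (hL₀ : Valued.v ((g₁ : Matrix (Fin 3) (Fin 3) F)).charpoly.discr = WithZero.exp (-(L₀ : ℤ))) :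
    ∃ R₀ : ℕ, R₀ ≤ 108 * (s₀ + h + L₀ + 1) ∧ ∀ n : ℕ,
      ∫ z in Ω n, B u' (ρ (z * QuotientGroup.mk g₁ * z⁻¹) u) ∂μ' = ∫ z in Ω n ∩ Ω R₀, B u' (ρ (z * QuotientGroup.mk g₁ * z⁻¹) u) ∂μ' := by
  -- companion normal form `g₁ = y' γ y'⁻¹`
  obtain ⟨y₂, hy₂⟩ := exists_leviBlock_eq_conj_companion e hirr
  set T : F := e 0 + e 3 with hTdef
  set N₀ : F := e 0 * e 3 - e 1 * e 2 with hN₀def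
  set c₀ : F := e 4 with hc₀def
  have hg' : (g₁ : Matrix (Fin 3) (Fin 3) F) = ((y * y₂ : GL (Fin 3) F) : Matrix (Fin 3) (Fin 3) F) * !![0, -N₀, 0; 1, T, 0; 0, 0, c₀] *
      (((y * y₂)⁻¹ : GL (Fin 3) F) : Matrix (Fin 3) (Fin 3) F) := by
    rw [hg, hy₂, mul_inv_rev, Units.val_mul, Units.val_mul]
    simp only [Matrix.mul_assoc]
  obtain ⟨γ, hγ, hg₁⟩ := exists_conj_eq_of_coe hg'
  set y' : GL (Fin 3) F := y * y₂ with hy'def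
  have hπ : ∀ x : F, x ^ 2 - T * x + N₀ ≠ 0 := by
    refine forall_sq_sub_add_ne_zero_of_irreducible ?_
    rw [← charpoly_block_eq e]; exact hirr
  have hy : ∀ i j, Valued.v ((((y' * γ * y'⁻¹ : GL (Fin 3) F)) : Matrix (Fin 3) (Fin 3) F) i j) ≤ 1 := by rw [← hg₁]; exact hint
  have hs : ∀ i j, Valued.v (ϖ ^ h * ((((y' * γ * y'⁻¹)⁻¹ : GL (Fin 3) F)) : Matrix (Fin 3) (Fin 3) F) i j) ≤ 1 := by rw [← hg₁]; exact hinv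
  have hT1 : Valued.v T ≤ 1 := v_T_le_one hγ hy
  have hN1 : Valued.v N₀ ≤ 1 := v_N_le_one hγ hy
  have hc1 : Valued.v c₀ ≤ 1 := v_c_le_one hγ hy
  have hdisc : ((g₁ : Matrix (Fin 3) (Fin 3) F)).charpoly.discr = (T ^ 2 - 4 * N₀) * (c₀ ^ 2 - T * c₀ + N₀) ^ 2 := by
    rw [hg, Matrix.coe_units_inv, Matrix.charpoly_units_conj, discr_charpoly_leviBlock]
  have hϖL : Valued.v (ϖ ^ L₀) = WithZero.exp (-(L₀ : ℤ)) := by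
    rw [map_pow, hϖ, ← WithZero.exp_nsmul]; congr 1; simp
  have hπc1 : Valued.v (c₀ ^ 2 - T * c₀ + N₀) ≤ 1 := by
    refine (Valuation.map_add _ _ _).trans (max_le (v_sub_le_one ?_ ?_) hN1)
    · rw [map_pow]; exact pow_le_one₀ zero_le hc1
    · rw [map_mul]; exact mul_le_one' hT1 hc1
  -- depth hypotheses: homogeneous (for T18) and plain (for ★ p21), `L = L_d = L₀`
  have hD : Valued.v (ϖ ^ L₀ * (N₀ * c₀) ^ 2) ≤ Valued.v ((T ^ 2 - 4 * N₀) * (c₀ ^ 2 - T * c₀ + N₀) ^ 2) := by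
    rw [map_mul, hϖL, ← hL₀, hdisc]
    refine mul_le_of_le_one_right zero_le ?_
    rw [map_pow, map_mul]
    exact pow_le_one₀ zero_le (mul_le_one' hN1 hc1)
  have hD' : Valued.v (ϖ ^ L₀) ≤ Valued.v ((T ^ 2 - 4 * N₀) * (c₀ ^ 2 - T * c₀ + N₀) ^ 2) := by rw [hϖL, ← hL₀, hdisc]
  have hLd : Valued.v (ϖ ^ L₀) ≤ Valued.v (T ^ 2 - 4 * N₀) := by
    rw [hϖL, ← hL₀, hdisc, map_mul]
    refine mul_le_of_le_one_right zero_le ?_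
    rw [map_pow]; exact pow_le_one₀ zero_le hπc1
  -- conjugator of bounded height (★ T18-mixed-normalised)
  obtain ⟨t, ht, hyt⟩ := exists_adBall_mul_centralizer_of_conj_integral_mixed_normalised hϖ0 hγ hπ hy hs hD
  have hconj : (y' * t) * γ * (y' * t)⁻¹ = g₁ := by
    rw [hg₁]
    calc (y' * t) * γ * (y' * t)⁻¹ = y' * (t * γ * t⁻¹) * y'⁻¹ := by group
      _ = y' * γ * y'⁻¹ := by rw [ht, mul_inv_cancel_right]
  refine ⟨(9 * s₀ + L₀ + L₀) + (1 + 2 * (6 * h + L₀) + 4 * (9 * s₀ + L₀ + L₀)) + (6 * h + L₀), by omega, fun n => ?_⟩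
  have key := setIntegral_conj_eq_setIntegral_inter_mixed hϖ hϖ0 ρ hρ hsc hBinv u u' Ω hmem hK μ' hθ hγ hπ hT1 hN1 hc1 hD' hLd hyt n
  rwa [hconj] at key

end PerPoint

/-! ## §2 The leaf -/

/-- **HARISH-CHANDRA'S NON-ELLIPTIC ESTIMATES ON `G' = GL₃(F) ⧸ ϖ^ℤ` FOR A SUPERCUSPIDAL MATRIX COEFFICIENT** — the hosted leaf (11-3-split-sc-NE)
`U12Characters.sig_K2E3GL3ModUniformizerNonEllEstimates`, statement VERBATIM (= hypothesis `hNE` of ★ B6-final `charLocIntNear_gl3_supercuspidal_of_nonell`): for `F` a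
characteristic-`0` non-archimedean local field with uniformizer `ϖ`, every Haar `μ` on `G'`, every smooth irreducible supercuspidal `r`, every `r`-invariant sesquilinear `B`
and every `v₁`, there are a compact exhaustion `Ω` of `G'` and `Fl`, `M` with: for `μ`-a.e. `g` with non-compact centraliser `∫_{Ω n} B v₁ (r(x g x⁻¹) v₁) → Fl g`; for
every `n`, a.e. `‖∫_{Ω n} …‖ ≤ M g`; and `M ∈ L¹_loc(μ)`.  Road «GL-[M6]-sc»: ★ height-ball exhaustion ∘ ★ `nonEllEstimates_of_hcancMixed` ∘ §1.
[cite: HarishChandra1970, Part V §6 Thm 15 p. 63; Part VII §2 Thms 18–20 pp. 69–70, §3 pp. 70–73] [cite: Rogawski1990, §12.2 p. 173] -/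
theorem nonEllEstimates_modUniformizer :
  ∀ (F : Type) [Field F] [Valued F ℤᵐ⁰] [ValuativeRel F] [(Valued.v : Valuation F ℤᵐ⁰).Compatible] [IsNonarchimedeanLocalField F] [CharZero F]
    (ϖ : F) (hϖ : Valued.v ϖ = WithZero.exp (-1 : ℤ)) (hϖ0 : ϖ ≠ 0)
    [((Subgroup.zpowers (Units.mk0 ϖ hϖ0)).map (Matrix.GeneralLinearGroup.scalar (Fin 3))).Normal]
    [MeasurableSpace (GL (Fin 3) F ⧸ (Subgroup.zpowers (Units.mk0 ϖ hϖ0)).map (Matrix.GeneralLinearGroup.scalar (Fin 3)))]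
    [BorelSpace (GL (Fin 3) F ⧸ (Subgroup.zpowers (Units.mk0 ϖ hϖ0)).map (Matrix.GeneralLinearGroup.scalar (Fin 3)))]
    (μ : Measure (GL (Fin 3) F ⧸ (Subgroup.zpowers (Units.mk0 ϖ hϖ0)).map (Matrix.GeneralLinearGroup.scalar (Fin 3)))) [μ.IsHaarMeasure]
    (r : SmoothIrrep (GL (Fin 3) F ⧸ (Subgroup.zpowers (Units.mk0 ϖ hϖ0)).map (Matrix.GeneralLinearGroup.scalar (Fin 3)))), r.ρ.IsSupercuspidal →
    ∀ (B : r.V →ₗ⋆[ℂ] r.V →ₗ[ℂ] ℂ),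
      (∀ (g : GL (Fin 3) F ⧸ (Subgroup.zpowers (Units.mk0 ϖ hϖ0)).map (Matrix.GeneralLinearGroup.scalar (Fin 3))) (x y : r.V), B (r.ρ g x) (r.ρ g y) = B x y) →
    ∀ (v₁ : r.V),
      ∃ (Ω : CompactExhaustion (GL (Fin 3) F ⧸ (Subgroup.zpowers (Units.mk0 ϖ hϖ0)).map (Matrix.GeneralLinearGroup.scalar (Fin 3))))
        (Fl : (GL (Fin 3) F ⧸ (Subgroup.zpowers (Units.mk0 ϖ hϖ0)).map (Matrix.GeneralLinearGroup.scalar (Fin 3))) → ℂ)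
        (M : (GL (Fin 3) F ⧸ (Subgroup.zpowers (Units.mk0 ϖ hϖ0)).map (Matrix.GeneralLinearGroup.scalar (Fin 3))) → ℝ),
        (∀ᵐ g ∂μ, ¬ IsCompact ((Subgroup.centralizer ({g} : Set (GL (Fin 3) F ⧸ (Subgroup.zpowers (Units.mk0 ϖ hϖ0)).map (Matrix.GeneralLinearGroup.scalar (Fin 3))))) :
            Set (GL (Fin 3) F ⧸ (Subgroup.zpowers (Units.mk0 ϖ hϖ0)).map (Matrix.GeneralLinearGroup.scalar (Fin 3)))) →
          Tendsto (fun n => ∫ x in Ω n, B v₁ (r.ρ (x * g * x⁻¹) v₁) ∂μ) atTop (𝓝 (Fl g))) ∧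
        (∀ n, ∀ᵐ g ∂μ, ¬ IsCompact ((Subgroup.centralizer ({g} : Set (GL (Fin 3) F ⧸ (Subgroup.zpowers (Units.mk0 ϖ hϖ0)).map (Matrix.GeneralLinearGroup.scalar (Fin 3))))) :
            Set (GL (Fin 3) F ⧸ (Subgroup.zpowers (Units.mk0 ϖ hϖ0)).map (Matrix.GeneralLinearGroup.scalar (Fin 3)))) →
          ‖∫ x in Ω n, B v₁ (r.ρ (x * g * x⁻¹) v₁) ∂μ‖ ≤ M g) ∧
        LocallyIntegrable M μ := by
  intro F _ _ _ _ _ _ ϖ hϖ hϖ0 _ _ _ μ _ r hsc B hBinv v₁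
  letI : MeasurableSpace F := borel F
  haveI : BorelSpace F := ⟨rfl⟩
  letI : MeasurableSpace (GL (Fin 3) F) := borel _
  haveI : BorelSpace (GL (Fin 3) F) := ⟨rfl⟩
  haveI : CompactSpace (Fˣ ⧸ Subgroup.zpowers (Units.mk0 ϖ hϖ0)) := compactSpace_units_quot_zpowers_uniformizer hϖ hϖ0
  obtain ⟨Ω, hmem, -, -, -, hK, -, -, -⟩ := exists_adHeightBall_compactExhaustion_quotScalar (Subgroup.zpowers (Units.mk0 ϖ hϖ0)) hϖ hϖ0
  exact ⟨Ω, nonEllEstimates_of_hcancMixed hϖ hϖ0 μ r hsc B hBinv v₁ Ω hmem hK 108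
    (fun s₀ hs₀ g₁ y e h L₀ hirr hg hint hinv hL₀ =>
      hcanc_mixed_pointwise hϖ hϖ0 r.ρ r.isSmooth hsc hBinv v₁ v₁ Ω hmem hK μ hs₀ g₁ y e h L₀ hirr hg hint hinv hL₀)⟩

end Summit.HodgeConjecture.HodgeConjecture.Cruxes.H413.K2E3GL3ModUniformizerNonEllEstimates

end
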